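import Summits.Ventures.Crystal3D.Theorems.StickyWulffConstantCoaxialWallLawWordMovesGen
import Summits.Ventures.Crystal3D.Theorems.StickyWulffConstantCoaxialWallLawEndDichotomy
import HarnessLib

/-!
# The word automaton at every version: a single-valued move map with the NARROW move, and the two payers of an end

HONEST FRAMING. Venture `Summits/Ventures/Crystal3D` (cell `crystal3d-full`), helper `--supports` the crux
`CoaxialWallLaw` of `route-Ventures-StickyWulffConstant` (REGISTERED line `WallLedgerF`).  Rung credit; F-C1 not
moved; no census.  cf-p1 g28 (xxxviii″): version-parametric companions of `exists_word_move_map` (`…WordInstance`)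
and `word_reachable_end_two_payers` (`…EndDichotomy`), in the typed vocabulary of `…EndRowDefs`:

* `exists_word_move_map_gen` — a move map `f` on states `(b, κ)`: straight `(b + d κ, κ)` at a FULL shell, at a
  twin-dozen GLIDE reading and at a NARROW reading; `(b + d (next κ m), next κ m)` at a twin-dozen reading CROSSING
  along `m`.  Single-valued because a crossing reading is neither full nor narrow (`not_isNarrow_of_twinReading_cross`)
  and its normal is unique (`twinDozen_normal_eq_self`).
* `certified_end_dichotomy`, **`certified_end_two_payers`** — a CERTIFIED state (ball in `X`, a `60°` triangle of
  occupied slots, predecessor ball occupied) that is neither full nor reads a twin dozen along a normal crossing or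
  containing its direction has `≤ 11` contacts or two distinct contact neighbours with `≤ 11` contacts (the dozen
  step `fullShell_or_twinDozen_of_allButOne`; inputs `KissingGap δ`, `KissingClassification δ` by name).  Every
  `ver`-end of the automaton is such a state, whatever the version.
WHAT THIS IS NOT: the count and the exports are the next files; F-C1 not moved.
-/

noncomputable section

namespace Summit.Ventures.Crystal3D.Theorems

open Summit.Ventures.Crystal3D Finset
open Literature.MathematicalPhysics.StatisticalMechanics (fccStacking)
open scoped InnerProductSpace

section MoveMap

variable {K : Type*}

open scoped Classical in
/-- **A move map for the word automaton, with the NARROW straight move.**  See the module docstring. -/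
theorem exists_word_move_map_gen (X : Finset (EuclideanSpace ℝ (Fin 3)))
    (F : K → (EuclideanSpace ℝ (Fin 3) ≃ₗᵢ[ℝ] EuclideanSpace ℝ (Fin 3))) (d : K → EuclideanSpace ℝ (Fin 3))
    (next : K → EuclideanSpace ℝ (Fin 3) → K) (hd : ∀ κ, ∃ u ∈ fccSlots, d κ = F κ u) :
    ∃ f : EuclideanSpace ℝ (Fin 3) × K → EuclideanSpace ℝ (Fin 3) × K,
      (∀ v, IsFull X (F v.2) v.1 → f v = (v.1 + d v.2, v.2)) ∧
      (∀ v, ∀ m : EuclideanSpace ℝ (Fin 3), IsTwinReading X (F v.2) m v.1 →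
        ⟪d v.2, m⟫_ℝ = Real.sqrt (2 / 3) → f v = (v.1 + d (next v.2 m), next v.2 m)) ∧
      (∀ v, ∀ m : EuclideanSpace ℝ (Fin 3), IsTwinReading X (F v.2) m v.1 →
        ⟪d v.2, m⟫_ℝ = 0 → f v = (v.1 + d v.2, v.2)) ∧
      (∀ v, IsNarrow X (F v.2) (d v.2) v.1 → f v = (v.1 + d v.2, v.2)) := by
  have hr : 0 < Real.sqrt (2 / 3) := Real.sqrt_pos.2 (by norm_num)
  -- crossing readings
  set cross : EuclideanSpace ℝ (Fin 3) × K → EuclideanSpace ℝ (Fin 3) → Prop := fun v m =>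
    IsTwinReading X (F v.2) m v.1 ∧ ⟪d v.2, m⟫_ℝ = Real.sqrt (2 / 3) with hcross
  set f : EuclideanSpace ℝ (Fin 3) × K → EuclideanSpace ℝ (Fin 3) × K := fun v =>
    @dite _ (∃ m, cross v m) (Classical.propDecidable _)
      (fun h => (v.1 + d (next v.2 (Classical.choose h)), next v.2 (Classical.choose h)))
      (fun _ => (v.1 + d v.2, v.2)) with hfdef
  -- at a crossing reading the normal is unique, and the state is neither full nor narrow nor gliding
  have huniq : ∀ (v : EuclideanSpace ℝ (Fin 3) × K) (m m' : EuclideanSpace ℝ (Fin 3)),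
      IsTwinReading X (F v.2) m v.1 → IsTwinReading X (F v.2) m' v.1 → m = m' := by
    intro v m m' h h'
    exact twinDozen_normal_eq_self (F v.2) h.1.1 h'.1.1 h.1.2 h'.1.2 h.2.1 h'.2.2.2
  have hstraight : ∀ v : EuclideanSpace ℝ (Fin 3) × K, (¬ ∃ m, cross v m) → f v = (v.1 + d v.2, v.2) := by
    intro v hnex
    simp only [hfdef]
    rw [dif_neg hnex]
  refine ⟨f, fun v hfull => hstraight v ?_, fun v m htd hdm => ?_, fun v m htd hdm => hstraight v ?_,
    fun v hnar => hstraight v ?_⟩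
  · rintro ⟨m, htd, hdm⟩
    obtain ⟨u, hu, hdu⟩ := hd v.2
    exact not_isFull_of_twinReading_cross (F v.2) htd hu hdu hdm hfull
  · have hex : ∃ m', cross v m' := ⟨m, htd, hdm⟩
    simp only [hfdef]
    rw [dif_pos hex]
    have heq : Classical.choose hex = m := huniq v _ _ (Classical.choose_spec hex).1 htd
    rw [heq]
  · rintro ⟨m', htd', hdm'⟩
    have heq : m' = m := huniq v _ _ htd' htd
    rw [heq, hdm] at hdm'
    exact hr.ne' hdm'.symm
  · rintro ⟨m, htd, hdm⟩
    obtain ⟨u, hu, hdu⟩ := hd v.2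
    exact not_isNarrow_of_twinReading_cross (F v.2) htd hu hdu hdm hnar

end MoveMap

section Ends

variable {X : Finset (EuclideanSpace ℝ (Fin 3))}
  {K : Type*} {F : K → (EuclideanSpace ℝ (Fin 3) ≃ₗᵢ[ℝ] EuclideanSpace ℝ (Fin 3))}
  {d : K → EuclideanSpace ℝ (Fin 3)} {W : Finset (EuclideanSpace ℝ (Fin 3) × K)}

open scoped Classical in
/-- **A certified END is unsaturated or has, away from any given ball, an unsaturated contact neighbour.**  See the
module docstring. -/
theorem certified_end_dichotomy {δ : ℝ} (hg : KissingGap δ) (hc : KissingClassification δ)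
    (hX : ∀ p ∈ X, ∀ q ∈ X, p ≠ q → 1 ≤ dist p q)
    (hd : ∀ κ, ∃ u ∈ fccSlots, d κ = F κ u)
    (hW : ∀ v, v ∈ W ↔ (v.1 ∈ X ∧
      (∃ a ∈ fccSlots, ∃ a' ∈ fccSlots, ∃ a'' ∈ fccSlots,
        ⟪a, a'⟫_ℝ = 1 / 2 ∧ ⟪a, a''⟫_ℝ = 1 / 2 ∧ ⟪a', a''⟫_ℝ = 1 / 2 ∧
        v.1 + F v.2 a ∈ X ∧ v.1 + F v.2 a' ∈ X ∧ v.1 + F v.2 a'' ∈ X) ∧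
      v.1 - d v.2 ∈ X))
    {e : EuclideanSpace ℝ (Fin 3) × K} (he : e ∈ W) (hnf : ¬ IsFull X (F e.2) e.1)
    (hnt : ¬ ∃ m, IsTwinReading X (F e.2) m e.1 ∧ (⟪d e.2, m⟫_ℝ = Real.sqrt (2 / 3) ∨ ⟪d e.2, m⟫_ℝ = 0))
    (y₀ : EuclideanSpace ℝ (Fin 3)) :
    (X.filter fun q => dist e.1 q = 1).card ≤ 11 ∨
      ∃ z ∈ X, dist e.1 z = 1 ∧ z ≠ y₀ ∧ (X.filter fun q => dist z q = 1).card ≤ 11 := by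
  have hr : 0 < Real.sqrt (2 / 3) := Real.sqrt_pos.2 (by norm_num)
  obtain ⟨-, ⟨a, ha, a', ha', a'', ha'', i1, i2, i3, h1, h2, h3⟩, hpred⟩ := (hW _).1 he
  have hind : LinearIndependent ℝ ![a, a', a''] := linearIndependent_of_pairwise_half ha ha' ha'' i1 i2 i3
  by_contra hcon
  push Not at hcon
  obtain ⟨h11, hnb⟩ := hcon
  have h12 : (X.filter fun q => dist e.1 q = 1).card = 12 :=
    le_antisymm (card_filter_dist_eq_one_le_twelve X hX _) (by omega)
  have hnb' : ∀ z ∈ X, dist e.1 z = 1 → z ≠ y₀ → (X.filter fun q => dist z q = 1).card = 12 := by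
    intro z hz hdz hne
    exact le_antisymm (card_filter_dist_eq_one_le_twelve X hX _) (by have := hnb z hz hdz hne; omega)
  -- the dozen step in the state's own frame
  rcases fullShell_or_twinDozen_of_allButOne hg hc hX h12 y₀ hnb' (F e.2) ha ha' ha'' hind h1 h2 h3 with
    hfull | ⟨n, hn, hmenu, hown, hmir, hfar, -, -, -⟩
  · exact hnf hfull
  · -- the predecessor occupies slot `−u`, so the direction is on the closed positive side of `n`
    obtain ⟨u, hu, hdu⟩ := hd e.2
    have hnu : -u ∈ fccSlots := neg_mem_fccSlots hu
    have hle : ⟪F e.2 (-u), n⟫_ℝ ≤ 0 := by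
      by_contra hpos
      push Not at hpos
      apply hfar (-u) hnu hpos
      have : e.1 + F e.2 (-u) = e.1 - d e.2 := by rw [map_neg, hdu, sub_eq_add_neg]
      rw [this]; exact hpred
    have hge : 0 ≤ ⟪d e.2, n⟫_ℝ := by
      rw [hdu]; rw [map_neg, inner_neg_left] at hle; linarith
    have hdir : ⟪d e.2, n⟫_ℝ = Real.sqrt (2 / 3) ∨ ⟪d e.2, n⟫_ℝ = 0 := by
      rcases hmenu u hu with h0 | h0 | h0
      · exact Or.inr (by rw [hdu]; exact h0)
      · exact Or.inl (by rw [hdu]; exact h0)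
      · exfalso; rw [hdu] at hge; rw [h0] at hge; linarith
    exact hnt ⟨n, ⟨⟨hn, hmenu⟩, hown, hmir, hfar⟩, hdir⟩

open scoped Classical in
/-- **A certified END is unsaturated or has two DISTINCT unsaturated contact neighbours** (census-free, every
version).  See the module docstring. -/
theorem certified_end_two_payers {δ : ℝ} (hg : KissingGap δ) (hc : KissingClassification δ)
    (hX : ∀ p ∈ X, ∀ q ∈ X, p ≠ q → 1 ≤ dist p q)
    (hd : ∀ κ, ∃ u ∈ fccSlots, d κ = F κ u)
    (hW : ∀ v, v ∈ W ↔ (v.1 ∈ X ∧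
      (∃ a ∈ fccSlots, ∃ a' ∈ fccSlots, ∃ a'' ∈ fccSlots,
        ⟪a, a'⟫_ℝ = 1 / 2 ∧ ⟪a, a''⟫_ℝ = 1 / 2 ∧ ⟪a', a''⟫_ℝ = 1 / 2 ∧
        v.1 + F v.2 a ∈ X ∧ v.1 + F v.2 a' ∈ X ∧ v.1 + F v.2 a'' ∈ X) ∧
      v.1 - d v.2 ∈ X))
    {e : EuclideanSpace ℝ (Fin 3) × K} (he : e ∈ W) (hnf : ¬ IsFull X (F e.2) e.1)
    (hnt : ¬ ∃ m, IsTwinReading X (F e.2) m e.1 ∧ (⟪d e.2, m⟫_ℝ = Real.sqrt (2 / 3) ∨ ⟪d e.2, m⟫_ℝ = 0)) :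
    (X.filter fun q => dist e.1 q = 1).card ≤ 11 ∨
      ∃ z₁ ∈ X, ∃ z₂ ∈ X, z₁ ≠ z₂ ∧ dist e.1 z₁ = 1 ∧ dist e.1 z₂ = 1 ∧
        (X.filter fun q => dist z₁ q = 1).card ≤ 11 ∧ (X.filter fun q => dist z₂ q = 1).card ≤ 11 := by
  rcases certified_end_dichotomy hg hc hX hd hW he hnf hnt e.1 with h11 | ⟨z₁, hz₁, hd₁, -, hc₁⟩
  · exact Or.inl h11
  rcases certified_end_dichotomy hg hc hX hd hW he hnf hnt z₁ with h11 | ⟨z₂, hz₂, hd₂, hne, hc₂⟩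
  · exact Or.inl h11
  exact Or.inr ⟨z₁, hz₁, z₂, hz₂, fun h => hne (h ▸ rfl), hd₁, hd₂, hc₁, hc₂⟩

/-- A `ver`-END (not `ver`-moving) is in particular neither full nor twin-reading along a crossing/glide normal. -/
theorem not_full_not_twin_of_not_isMoving {ver : WordVersion}
    {G : EuclideanSpace ℝ (Fin 3) ≃ₗᵢ[ℝ] EuclideanSpace ℝ (Fin 3)} {dd b : EuclideanSpace ℝ (Fin 3)}
    (h : ¬ IsMoving X ver G dd b) :
    ¬ IsFull X G b ∧ ¬ ∃ m, IsTwinReading X G m b ∧ (⟪dd, m⟫_ℝ = Real.sqrt (2 / 3) ∨ ⟪dd, m⟫_ℝ = 0) :=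
  ⟨fun hf => h (Or.inl hf), fun ht => h (Or.inr (Or.inl ht))⟩

end Ends

end Summit.Ventures.Crystal3D.Theorems

end
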